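import Mathlib
import HarnessLib

/-!
# Weak convergence plus uniform exponential moments: convergence on exponentially dominated observables

`--supports stmt-AtomisticToContinuum-11976` helper file (crux `VanishingNoiseBound`, route
`VanishingNoiseTransfer`, line `fekete-usc-one-length`, stub S3 `stub_noisyPositiveConductance`, wave 3).
An ABSTRACT measure-theoretic lemma (no chain vocabulary), the `δ`-family form of the energy-truncation
argument of `…LinearResponseFTURBondHeatVarianceContinuityHelper5` (crux 9122): if a family of measures `m δ`
converges weakly to `m₀` as `δ → 0`, `δ ≠ 0` on bounded continuous observables, and the exponential weight
`e^{ϑW}` (`W ≥ 0` continuous) has integrals `≤ M` under all `m δ`, `|δ| ≤ T`, and under `m₀`, then `∫ g d(m δ) →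
∫ g dm₀` for every continuous `g` with `|g| ≤ C e^{ϑ'W}`, `0 ≤ ϑ' < ϑ`: truncate `g` with the continuous cutoff
`χ_K(W) = (K + 1 − W)⁺ ∧ 1`; the bounded part converges weakly and the tails are `≤ C e^{−(ϑ−ϑ')K} M` uniformly.

* `tendsto_integral_of_dominated_growth` — the statement above;
* `helper_weakLimitGrowth` — registered helper (notation-free restatement).

It is applied (companion file `…FlipWeakContinuity.lean`) to the unique flip-steady family of the velocity-flip
chain with `W = H`, `ϑ = 1/(2T)`. References: folklore (Prokhorov/uniform integrability).
-/

noncomputable section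

open MeasureTheory Filter Topology Set
open scoped Topology

namespace Summit.AtomisticToContinuum.FouriersLaw.Theorems.VanishingNoiseBound

variable {X : Type*} [TopologicalSpace X] [MeasurableSpace X] [OpensMeasurableSpace X]

/-- **Weak convergence on bounded continuous observables plus uniform exponential moments give convergence on
exponentially dominated continuous observables.** See the module docstring. [folklore] -/
theorem tendsto_integral_of_dominated_growth (m : ℝ → Measure X) (m₀ : Measure X) {W : X → ℝ}
    (hW : Continuous W) (hW0 : ∀ x, 0 ≤ W x) {ϑ ϑ' : ℝ} (hϑ'0 : 0 ≤ ϑ') (hϑ'1 : ϑ' < ϑ) {M T : ℝ} (hT : 0 < T)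
    (hM : ∀ δ : ℝ, |δ| ≤ T → Integrable (fun x => Real.exp (ϑ * W x)) (m δ) ∧
      ∫ x, Real.exp (ϑ * W x) ∂(m δ) ≤ M)
    (hM0 : Integrable (fun x => Real.exp (ϑ * W x)) m₀ ∧ ∫ x, Real.exp (ϑ * W x) ∂m₀ ≤ M)
    (hweak : ∀ g : X → ℝ, Continuous g → ∀ C : ℝ, (∀ x, |g x| ≤ C) →
      Tendsto (fun δ : ℝ => ∫ x, g x ∂(m δ)) (𝓝[≠] 0) (𝓝 (∫ x, g x ∂m₀)))
    {g : X → ℝ} (hg : Continuous g) {C : ℝ} (hgC : ∀ x, |g x| ≤ C * Real.exp (ϑ' * W x)) :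
    (∀ δ : ℝ, |δ| ≤ T → Integrable g (m δ)) ∧
      Tendsto (fun δ : ℝ => ∫ x, g x ∂(m δ)) (𝓝[≠] 0) (𝓝 (∫ x, g x ∂m₀)) := by
  -- adapted from `LinearResponseFTUR.ness_tendsto_integral_of_growth` (…BondHeatVarianceContinuityHelper5)
  set V : X → ℝ := fun x => Real.exp (ϑ * W x) with hV
  have hMnn : 0 ≤ M := le_trans (integral_nonneg fun x => (Real.exp_pos _).le) hM0.2
  -- `0 ≤ C` (if `X` is empty everything is trivial, so argue through a point when available)
  have hexp_le : ∀ x, Real.exp (ϑ' * W x) ≤ V x := fun x =>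
    Real.exp_le_exp.2 (mul_le_mul_of_nonneg_right hϑ'1.le (hW0 x))
  have hdom : ∀ x, ‖g x‖ ≤ |C| * V x := fun x => by
    rw [Real.norm_eq_abs]
    exact (hgC x).trans ((mul_le_mul_of_nonneg_left (hexp_le x) (le_trans (by
      have := (abs_nonneg (g x)).trans (hgC x)
      exact le_of_mul_le_mul_right (by simpa using this) (Real.exp_pos _)) le_rfl)).trans
        (mul_le_mul_of_nonneg_right (le_abs_self C) (Real.exp_pos _).le))
  have hint_of : ∀ ν : Measure X, Integrable V ν → Integrable g ν := fun ν hν =>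
    (hν.const_mul |C|).mono' hg.aestronglyMeasurable (Eventually.of_forall hdom)
  have hintδ : ∀ δ : ℝ, |δ| ≤ T → Integrable g (m δ) := fun δ hδ => hint_of _ (hM δ hδ).1
  refine ⟨hintδ, ?_⟩
  set C' : ℝ := |C| with hC'
  have hC0 : 0 ≤ C' := abs_nonneg C
  have hgC' : ∀ x, |g x| ≤ C' * Real.exp (ϑ' * W x) := fun x =>
    (hgC x).trans (mul_le_mul_of_nonneg_right (le_abs_self C) (Real.exp_pos _).le)
  -- the continuous cutoff and the truncated observable
  let χ : ℝ → X → ℝ := fun K x => max 0 (min 1 (K + 1 - W x))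
  have hχc : ∀ K, Continuous (χ K) := fun K => continuous_const.max (continuous_const.min (continuous_const.sub hW))
  have hχ0 : ∀ K x, 0 ≤ χ K x := fun K x => le_max_left _ _
  have hχ1 : ∀ K x, χ K x ≤ 1 := fun K x => max_le zero_le_one (min_le_left _ _)
  have hχ_one : ∀ K x, W x ≤ K → χ K x = 1 := fun K x hx => by
    show max 0 (min 1 (K + 1 - W x)) = 1
    rw [min_eq_left (by linarith only [hx]), max_eq_right zero_le_one]
  have hχ_zero : ∀ K x, K + 1 ≤ W x → χ K x = 0 := fun K x hx => by
    show max 0 (min 1 (K + 1 - W x)) = 0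
    rw [max_eq_left]
    exact min_le_of_right_le (by linarith only [hx])
  let gK : ℝ → X → ℝ := fun K x => χ K x * g x
  have hgKc : ∀ K, Continuous (gK K) := fun K => (hχc K).mul hg
  have hgK_bd : ∀ K x, |gK K x| ≤ C' * Real.exp (ϑ' * (K + 1)) := by
    intro K x
    show |χ K x * g x| ≤ _
    by_cases hx : W x ≤ K + 1
    · rw [abs_mul, abs_of_nonneg (hχ0 K x)]
      calc χ K x * |g x| ≤ 1 * |g x| := mul_le_mul_of_nonneg_right (hχ1 K x) (abs_nonneg _)
        _ ≤ C' * Real.exp (ϑ' * W x) := by rw [one_mul]; exact hgC' x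
        _ ≤ C' * Real.exp (ϑ' * (K + 1)) :=
            mul_le_mul_of_nonneg_left (Real.exp_le_exp.2 (mul_le_mul_of_nonneg_left hx hϑ'0)) hC0
    · rw [hχ_zero K x (le_of_lt (not_le.1 hx)), zero_mul, abs_zero]
      positivity
  -- the tails
  have htail : ∀ K x, ‖g x - gK K x‖ ≤ C' * Real.exp (-((ϑ - ϑ') * K)) * V x := by
    intro K x
    show ‖g x - χ K x * g x‖ ≤ _
    by_cases hx : W x ≤ K
    · rw [hχ_one K x hx, one_mul, sub_self, norm_zero]
      positivity
    · have hxK : K < W x := not_le.1 hx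
      have h1 : ‖g x - χ K x * g x‖ ≤ |g x| := by
        rw [show g x - χ K x * g x = (1 - χ K x) * g x by ring, norm_mul, Real.norm_eq_abs, Real.norm_eq_abs,
          abs_of_nonneg (by linarith only [hχ1 K x])]
        calc (1 - χ K x) * |g x| ≤ 1 * |g x| :=
              mul_le_mul_of_nonneg_right (by linarith only [hχ0 K x]) (abs_nonneg _)
          _ = |g x| := one_mul _
      refine h1.trans ((hgC' x).trans ?_)
      rw [mul_assoc, ← Real.exp_add]
      refine mul_le_mul_of_nonneg_left (Real.exp_le_exp.2 ?_) hC0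
      have : (ϑ - ϑ') * K ≤ (ϑ - ϑ') * W x := mul_le_mul_of_nonneg_left hxK.le (by linarith only [hϑ'1])
      nlinarith only [this]
  have htail_int : ∀ K (ν : Measure X), Integrable V ν → ∫ x, V x ∂ν ≤ M →
      dist (∫ x, g x ∂ν) (∫ x, gK K x ∂ν) ≤ C' * Real.exp (-((ϑ - ϑ') * K)) * M := by
    intro K ν hν hνM
    have hgi : Integrable g ν := hint_of ν hν
    have hgKi : Integrable (gK K) ν := by
      refine hgi.norm.mono' (hgKc K).aestronglyMeasurable (Eventually.of_forall fun x => ?_)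
      show ‖χ K x * g x‖ ≤ ‖g x‖
      rw [norm_mul, Real.norm_eq_abs, abs_of_nonneg (hχ0 K x)]
      calc χ K x * ‖g x‖ ≤ 1 * ‖g x‖ := mul_le_mul_of_nonneg_right (hχ1 K x) (norm_nonneg _)
        _ = ‖g x‖ := one_mul _
    rw [dist_eq_norm, ← integral_sub hgi hgKi]
    calc ‖∫ x, (g x - gK K x) ∂ν‖ ≤ ∫ x, ‖g x - gK K x‖ ∂ν := norm_integral_le_integral_norm _
      _ ≤ ∫ x, C' * Real.exp (-((ϑ - ϑ') * K)) * V x ∂ν :=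
          integral_mono_of_nonneg (Eventually.of_forall fun x => norm_nonneg _) (hν.const_mul _)
            (Eventually.of_forall (htail K))
      _ = C' * Real.exp (-((ϑ - ϑ') * K)) * ∫ x, V x ∂ν := integral_const_mul _ _
      _ ≤ C' * Real.exp (-((ϑ - ϑ') * K)) * M := mul_le_mul_of_nonneg_left hνM (by positivity)
  -- the `3ε` argument
  rw [Metric.tendsto_nhds]
  intro ε hε
  have hr : 0 < ϑ - ϑ' := by linarith only [hϑ'1]
  have hK : ∃ K : ℝ, C' * Real.exp (-((ϑ - ϑ') * K)) * M < ε / 3 := by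
    have h1 : Tendsto (fun K : ℝ => C' * Real.exp (-((ϑ - ϑ') * K)) * M) atTop (𝓝 (C' * 0 * M)) :=
      ((Real.tendsto_exp_neg_atTop_nhds_zero.comp (tendsto_id.const_mul_atTop hr)).const_mul C').mul_const M
    rw [mul_zero, zero_mul] at h1
    exact (h1.eventually (gt_mem_nhds (by positivity))).exists
  obtain ⟨K, hKε⟩ := hK
  have hwk := hweak (gK K) (hgKc K) (C' * Real.exp (ϑ' * (K + 1))) (hgK_bd K)
  rw [Metric.tendsto_nhds] at hwk
  have hbox : ∀ᶠ δ : ℝ in 𝓝[≠] 0, |δ| ≤ T := by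
    have : Metric.closedBall (0 : ℝ) T ∈ 𝓝[≠] (0 : ℝ) :=
      mem_nhdsWithin_of_mem_nhds (Metric.closedBall_mem_nhds 0 hT)
    filter_upwards [this] with δ hδ
    simpa [Real.dist_eq] using hδ
  filter_upwards [hwk (ε / 3) (by positivity), hbox] with δ hδ hδT
  have h1 := htail_int K (m δ) (hM δ hδT).1 (hM δ hδT).2
  have h3 := htail_int K m₀ hM0.1 hM0.2
  calc dist (∫ x, g x ∂(m δ)) (∫ x, g x ∂m₀)
      ≤ dist (∫ x, g x ∂(m δ)) (∫ x, gK K x ∂(m δ)) + dist (∫ x, gK K x ∂(m δ)) (∫ x, gK K x ∂m₀) +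
          dist (∫ x, gK K x ∂m₀) (∫ x, g x ∂m₀) := dist_triangle4 _ _ _ _
    _ < ε / 3 + ε / 3 + ε / 3 := by
        refine add_lt_add_of_lt_of_le (add_lt_add_of_le_of_lt (h1.trans hKε.le) hδ) ?_
        rw [dist_comm]
        exact h3.trans hKε.le
    _ = ε := by ring

/-! ## Registered helper -/

/-- Registered helper sub-goal `helper_weakLimitGrowth` of stub `stub_noisyPositiveConductance` (line
`fekete-usc-one-length`, crux stmt-AtomisticToContinuum-11976): weak convergence on bounded continuous
observables plus uniform exponential moments give convergence on exponentially dominated observables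
(`tendsto_integral_of_dominated_growth`). -/
theorem helper_weakLimitGrowth : ∀ {X : Type} [TopologicalSpace X] [MeasurableSpace X] [OpensMeasurableSpace X] (m : ℝ → MeasureTheory.Measure X) (m₀ : MeasureTheory.Measure X) (W : X → ℝ), Continuous W → (∀ x, 0 ≤ W x) → ∀ (ϑ ϑ' : ℝ), 0 ≤ ϑ' → ϑ' < ϑ → ∀ (M T : ℝ), 0 < T → (∀ δ : ℝ, |δ| ≤ T → MeasureTheory.Integrable (fun x => Real.exp (ϑ * W x)) (m δ) ∧ MeasureTheory.integral (m δ) (fun x => Real.exp (ϑ * W x)) ≤ M) → (MeasureTheory.Integrable (fun x => Real.exp (ϑ * W x)) m₀ ∧ MeasureTheory.integral m₀ (fun x => Real.exp (ϑ * W x)) ≤ M) → (∀ g : X → ℝ, Continuous g → ∀ C : ℝ, (∀ x, |g x| ≤ C) → Filter.Tendsto (fun δ : ℝ => MeasureTheory.integral (m δ) (fun x => g x)) (nhdsWithin 0 {(0 : ℝ)}ᶜ) (nhds (MeasureTheory.integral m₀ (fun x => g x)))) → ∀ (g : X → ℝ), Continuous g → ∀ C : ℝ, (∀ x, |g x| ≤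 C * Real.exp (ϑ' * W x)) → (∀ δ : ℝ, |δ| ≤ T → MeasureTheory.Integrable g (m δ)) ∧ Filter.Tendsto (fun δ : ℝ => MeasureTheory.integral (m δ) (fun x => g x)) (nhdsWithin 0 {(0 : ℝ)}ᶜ) (nhds (MeasureTheory.integral m₀ (fun x => g x))) :=
  fun m m₀ _ hW hW0 _ _ hϑ'0 hϑ'1 _ _ hT hM hM0 hweak _ hg _ hgC =>
    tendsto_integral_of_dominated_growth m m₀ hW hW0 hϑ'0 hϑ'1 hT hM hM0 hweak hg hgC

end Summit.AtomisticToContinuum.FouriersLaw.Theorems.VanishingNoiseBound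

end
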